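import Summits.BirchSwinnertonDyer.BirchSwinnertonDyer.Theorems.ByReductionTypeAtTwoGoodOrdTowerControlDualBound
import HarnessLib

set_option linter.dupNamespace false -- `…BirchSwinnertonDyer.BirchSwinnertonDyer…` is the cell's nested layout (D-0017)
set_option autoImplicit false

/-!
# Greenberg LNM 1716 Lemma 3.4 at the layers `n ≥ 1`, brick 2: local duality `(2,0)` over an OPEN subgroup —
# `#H²(H, M) = #Hom_H(M, μ_{p^k})` EXACTLY (Shapiro + Tate duality for the induced module + Frobenius reciprocity)

Seat `bsd-inputs-k4-p1` (gen 6; LADDER-BSD D-0154 KEY (147)(f) «prove the printed input», row 1 K4 INPUTS; Greenberg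
1999), `--supports stmt-BirchSwinnertonDyer-20309`. THEOREMS ONLY (no definition, no named fact, no `sorry`).

Cell bsd-2adic's BRICK D (`GoodOrdTower.finite_and_natCard_two_restrict_le`) proves, for a non-archimedean local field `F` of
characteristic `0`, an open normal `H ≤ Γ_F` and a finite discrete `p^k`-torsion `Γ_F`-module `M`, the INEQUALITY
`#H²(H, M) ≤ #Hom_H(M, μ_{p^k})` — Shapiro `H²(H, M) ≅ H²(Γ_F, M_Γ^H(M))`, Tate local duality
`#H²(Γ_F, X) = #Hom_Γ(X, μ)` for the induced module, and the injection `Hom_Γ(M_Γ^H(M), μ) ↪ Hom_H(M, μ)`, `Φ ↦ Φ ∘ j`.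
This file proves the other half of Frobenius reciprocity — every `H`-equivariant `f : M → μ` is `Φ_f ∘ j` for the
`Γ`-equivariant `Φ_f(a*) = ∑_{c ∈ Γ/H} c̃ · f(a*(c̃⁻¹))` (`c̃ = c.out`) — and hence the EQUALITY, which is Greenberg's use of
Tate duality over the completion of the LAYER field `(F_n)_{v_n}` (LNM 1716, proof of Prop. 2.5 / Lemma 3.4: "`H²(M, C)`
is dual to `Hom_{G_M}(C, μ_{p^∞})`") expressed on the open subgroup `H = Gal(F̄_v/(F_n)_{v_n}) ≤ Γ_{F_v}`:

* `finite_and_natCard_two_restrict_eq` — **`#H²(H, M) = #{f : M →+ μ_{p^k} | f H-equivariant}`**.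

HONEST FRAMING: group-cohomology bookkeeping (TOOL theorem); closes nothing; no summit statement is proved; BSD is not
proved by any of this.

References: [SerreGaloisCohomology1997] I §2.5 Prop. 10 (Shapiro), II §5.2 Thm. 2; [MilneADT2006] I Cor. 2.3;
[GreenbergLNM1716] §2 proof of Prop. 2.5 (pp. 78–80), §3 Lemma 3.4 (p. 89).
-/

noncomputable section

open scoped Classical

universe u

namespace Summit.BirchSwinnertonDyer.BirchSwinnertonDyer.Theorems.InputsGreenbergLemma34Layer

open CategoryTheory Field Literature.NumberTheory.GaloisRepresentations _root_.TopRep _root_.ContRepresentation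
  _root_.ContinuousCohomology Literature.NumberTheory.GaloisRepresentations.DiscreteGaloisModule

set_option maxHeartbeats 1600000 in
/-- **`#H²(H, M) = #Hom_H(M, μ_{p^k})` for an open normal subgroup `H ≤ Γ_F` and a finite `p^k`-torsion discrete
`Γ_F`-module `M`** (`F` a non-archimedean local field of characteristic `0`), with finiteness of `H²(H, M)`. Shapiro
`H²(H, M) ≅ H²(Γ_F, M_Γ^H(M))`, Tate local duality `#H²(Γ_F, X) = #Hom_Γ(X, μ_{p^k})` for the finite induced module, and
FROBENIUS RECIPROCITY `Hom_Γ(M_Γ^H(M), μ) ≅ Hom_H(M, μ)`: `Φ ↦ Φ ∘ j` (`j(m) = (x ↦ x m on H, 0 off H)`) is injective (cell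
bsd-2adic) and surjective — an `H`-equivariant `f` is hit by `Φ_f(a*) = ∑_{c ∈ Γ/H} c̃ · f(a*(c̃⁻¹))`, which is
`Γ`-equivariant because right multiplication by `g` permutes the right cosets `H c̃⁻¹`.
[cite: SerreGaloisCohomology1997, I §2.5 Prop. 10 and II §5.2] [cite: MilneADT2006, I Cor. 2.3]
[cite: GreenbergLNM1716, §2 Prop. 2.5 (pp. 78–80)] -/
theorem finite_and_natCard_two_restrict_eq (F : Type u) [Field F] [ValuativeRel F] [TopologicalSpace F]
    [IsNonarchimedeanLocalField F] [CharZero F]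
    (H : Subgroup (absoluteGaloisGroup F)) [H.Normal] (hHo : IsOpen (H : Set (absoluteGaloisGroup F)))
    {M : Type u} [AddCommGroup M] [TopologicalSpace M] [DiscreteTopology M] [Finite M]
    (ρ : ContinuousRep (absoluteGaloisGroup F) ℤ M) {p k : ℕ} [Fact p.Prime] (hM : ∀ m : M, p ^ k • m = 0) :
    Finite (continuousCohomology 2 (ρ.restrict (subgroupIncl H)).toTopRep) ∧
      Nat.card (continuousCohomology 2 (ρ.restrict (subgroupIncl H)).toTopRep) =
        Nat.card {f : M →+ MuCarrier F (p ^ k) // ∀ (h : H) (m : M),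
          f (ρ (h : absoluteGaloisGroup F) m) = mu F (p ^ k) (h : absoluteGaloisGroup F) (f m)} := by
  -- adapted from Summits/.../Theorems/ByReductionTypeAtTwoGoodOrdTowerControlDualBound.lean (cell bsd-2adic, BRICK D)
  -- notation and instances
  let Γ := absoluteGaloisGroup F
  haveI : CompactSpace Γ := absoluteGaloisGroup_compactSpace F
  haveI hHc : IsClosed (H : Set Γ) := Subgroup.isClosed_of_isOpen _ hHo
  haveI : DiscreteTopology (Γ ⧸ H) := QuotientGroup.discreteTopology hHo
  haveI : Finite (Γ ⧸ H) := finite_of_compact_of_discrete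
  letI : Fintype (Γ ⧸ H) := Fintype.ofFinite _
  haveI : CompactSpace H := compactSpace_of_isClosed_subgroup (S := H)
  let σ : ContinuousRep H ℤ M := ρ.restrict (subgroupIncl H)
  haveI : DiscreteTopology (coindModule σ) := discreteTopology_coind σ
  haveI : Finite (coindModule σ) := finite_coindModule F H ρ
  have hσ : ∀ (h : H) (m : M), σ h m = ρ (h : Γ) m := fun _ _ ↦ rfl
  let ω := mu F (p ^ k)
  -- Shapiro in degree `2`
  have eSh := shapiroEquiv H ρ 1
  -- local duality `(2,0)` for the finite induced module
  have hM' : ∀ f : coindModule σ, p ^ k • f = 0 := fun f ↦ Subtype.ext (by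
    ext x
    rw [Submodule.coe_smul_of_tower, ContinuousMap.coe_smul, Pi.smul_apply, hM, Submodule.coe_zero,
      ContinuousMap.zero_apply])
  obtain ⟨hfin2, hcard2⟩ := natCard_two_eq_natCard_invariants_homRep F (coindRep σ) hM'
  haveI := hfin2
  haveI hfinH : Finite (continuousCohomology 2 (ρ.restrict (subgroupIncl H)).toTopRep) := Finite.of_equiv _ eSh
  refine ⟨hfinH, ?_⟩
  rw [← Nat.card_congr eSh, hcard2]
  -- the embedding `j : M → M_Γ^H(M)`, `j(m)(x) = x m` on `H`, `0` off `H`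
  have hfront : ∀ m : M, ∀ a ∈ frontier {x : Γ | x ∈ H}, (fun x : Γ ↦ ρ x m) a = (fun _ : Γ ↦ (0 : M)) a := by
    intro m a ha
    have hcl : IsClopen {x : Γ | x ∈ H} := ⟨hHc, hHo⟩
    rw [hcl.frontier_eq] at ha
    exact absurd ha (Set.notMem_empty a)
  have hjcont : ∀ m : M, Continuous fun x : Γ ↦ if x ∈ H then ρ x m else 0 := fun m ↦
    continuous_if (hfront m) (ρ.continuous_apply_left m).continuousOn continuous_const.continuousOn
  have hjmem : ∀ m : M, (⟨fun x : Γ ↦ if x ∈ H then ρ x m else 0, hjcont m⟩ : C(Γ, M)) ∈ coindModule σ := by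
    intro m
    rw [mem_coind_iff]
    intro s x
    change (if (s : Γ) * x ∈ H then ρ ((s : Γ) * x) m else 0) = σ s (if x ∈ H then ρ x m else 0)
    by_cases hx : x ∈ H
    · rw [if_pos hx, if_pos (H.mul_mem s.2 hx), hσ, map_mul, Module.End.mul_apply]
    · have hsx : (s : Γ) * x ∉ H := fun h ↦ hx (by simpa using H.mul_mem (H.inv_mem s.2) h)
      rw [if_neg hx, if_neg hsx, map_zero]
  let j : M →+ coindModule σ :=
    { toFun := fun m ↦ ⟨_, hjmem m⟩
      map_zero' := Subtype.ext (ContinuousMap.ext fun x ↦ by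
        change (if x ∈ H then ρ x (0 : M) else 0) = 0
        rw [map_zero, ite_self])
      map_add' := fun m m' ↦ Subtype.ext (ContinuousMap.ext fun x ↦ by
        change (if x ∈ H then ρ x (m + m') else 0) =
          (if x ∈ H then ρ x m else 0) + (if x ∈ H then ρ x m' else 0)
        by_cases hx : x ∈ H
        · rw [if_pos hx, if_pos hx, if_pos hx, map_add]
        · rw [if_neg hx, if_neg hx, if_neg hx, add_zero]) }
  have hj : ∀ (m : M) (x : Γ), ((j m : coindModule σ) : C(Γ, M)) x = if x ∈ H then ρ x m else 0 := fun _ _ ↦ rfl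
  -- `j` is `H`-equivariant: `j(h m) = h · j(m)`
  have hjeq : ∀ (h : H) (m : M), j (ρ (h : Γ) m) = coindRep σ (h : Γ) (j m) := by
    intro h m
    refine Subtype.ext (ContinuousMap.ext fun x ↦ ?_)
    rw [hj, coindRep_apply_apply, hj]
    by_cases hx : x ∈ H
    · rw [if_pos hx, if_pos (H.mul_mem hx h.2), map_mul, Module.End.mul_apply]
    · have hxh : x * (h : Γ) ∉ H := fun h' ↦ hx (by simpa using H.mul_mem h' (H.inv_mem h.2))
      rw [if_neg hx, if_neg hxh]
  -- every `a* ∈ M_Γ^H(M)` is the sum over the cosets `c` of `c.out · j(a*(c.out⁻¹))`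
  have hdec : ∀ f : coindModule σ,
      f = ∑ c : Γ ⧸ H, coindRep σ c.out (j (((f : coindModule σ) : C(Γ, M)) c.out⁻¹)) := by
    intro f
    refine Subtype.ext (ContinuousMap.ext fun x ↦ ?_)
    rw [Submodule.coe_sum, ContinuousMap.coe_sum, Finset.sum_apply]
    -- only the coset `c₀ = x⁻¹ H` contributes
    have hx0 : x * (QuotientGroup.mk x⁻¹ : Γ ⧸ H).out ∈ H := by
      have h := QuotientGroup.out_eq' (QuotientGroup.mk x⁻¹ : Γ ⧸ H)
      rw [QuotientGroup.eq] at h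
      simpa using H.inv_mem h
    rw [Finset.sum_eq_single (QuotientGroup.mk x⁻¹ : Γ ⧸ H)]
    · rw [coindRep_apply_apply, hj, if_pos hx0]
      have h := (mem_coind_iff σ (f : C(Γ, M))).1 f.2 ⟨_, hx0⟩ ((QuotientGroup.mk x⁻¹ : Γ ⧸ H).out)⁻¹
      rw [hσ] at h
      change (f : C(Γ, M)) (x * _ * _) = _ at h
      rw [mul_inv_cancel_right] at h
      exact h
    · intro c _ hc
      rw [coindRep_apply_apply, hj, if_neg]
      intro hxc
      apply hc
      rw [← QuotientGroup.out_eq' c, eq_comm, QuotientGroup.eq, inv_inv]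
      exact hxc
    · intro h; exact absurd (Finset.mem_univ _) h
  -- invariants of `Hom(M_Γ^H(M), μ)` = `Γ`-equivariant maps
  have hinv : ∀ (Θ : ((coindRep σ).homRep ω).toTopRep.ρ.invariants) (g : Γ) (f : coindModule σ),
      (Θ : HomCarrier (coindModule σ) (MuCarrier F (p ^ k))) (coindRep σ g f) =
        ω g ((Θ : HomCarrier (coindModule σ) (MuCarrier F (p ^ k))) f) := fun Θ g f ↦
    ((ContinuousRep.homRep_apply_eq_self_iff (coindRep σ) ω g
      (Θ : HomCarrier (coindModule σ) (MuCarrier F (p ^ k)))).mp (Θ.2 g) f).symm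
  -- `Φ ↦ Φ ∘ j`
  let Ψ : ((coindRep σ).homRep ω).toTopRep.ρ.invariants →
      {f : M →+ MuCarrier F (p ^ k) // ∀ (h : H) (m : M), f (ρ (h : Γ) m) = ω (h : Γ) (f m)} :=
    fun Φ ↦ ⟨((Φ : HomCarrier (coindModule σ) (MuCarrier F (p ^ k))) : coindModule σ →+ MuCarrier F (p ^ k)).comp j,
      fun h m ↦ by
        rw [AddMonoidHom.comp_apply, AddMonoidHom.comp_apply, hjeq]
        exact hinv Φ (h : Γ) (j m)⟩
  -- injectivity (cell bsd-2adic)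
  have hΨ : Function.Injective Ψ := by
    intro Φ Φ' hΦ
    have hcomp : ∀ m : M, (Φ : HomCarrier (coindModule σ) (MuCarrier F (p ^ k))) (j m) =
        (Φ' : HomCarrier (coindModule σ) (MuCarrier F (p ^ k))) (j m) := fun m ↦ by
      have h := congrArg (fun f : {f : M →+ MuCarrier F (p ^ k) // ∀ (h : H) (m : M),
          f (ρ (h : Γ) m) = ω (h : Γ) (f m)} ↦ (f.1 m)) hΦ
      exact h
    refine Subtype.ext (HomCarrier.ext fun f ↦ ?_)
    rw [hdec f, map_sum, map_sum]
    refine Finset.sum_congr rfl fun c _ ↦ ?_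
    rw [hinv Φ, hinv Φ', hcomp]
  -- surjectivity: Frobenius reciprocity
  have hΨsurj : Function.Surjective Ψ := by
    rintro ⟨f, hf⟩
    -- the coset permutation data: for `g ∈ Γ`, `c ∈ Γ/H` and `c' = g⁻¹ • c`, `c̃⁻¹ g = h_c c̃'⁻¹` with `h_c ∈ H`
    have hperm : ∀ (g : Γ) (c : Γ ⧸ H), c.out⁻¹ * g * (g⁻¹ • c).out ∈ H := by
      intro g c
      have h1 : (QuotientGroup.mk (g⁻¹ * c.out) : Γ ⧸ H) = QuotientGroup.mk (g⁻¹ • c).out := by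
        rw [QuotientGroup.out_eq']
        exact MulAction.Quotient.coe_smul_out H g⁻¹ c
      have h2 := QuotientGroup.eq.mp h1
      rwa [mul_inv_rev, inv_inv, mul_assoc, ← mul_assoc] at h2
    -- the candidate `Φ_f(a*) = ∑_c c̃ · f(a*(c̃⁻¹))`
    let T : coindModule σ → (Γ ⧸ H) → MuCarrier F (p ^ k) := fun a c ↦ ω c.out (f ((a : C(Γ, M)) c.out⁻¹))
    let Θ₀ : coindModule σ →+ MuCarrier F (p ^ k) :=
      { toFun := fun a ↦ ∑ c : Γ ⧸ H, T a c
        map_zero' := by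
          change ∑ c : Γ ⧸ H, ω c.out (f (((0 : coindModule σ) : C(Γ, M)) c.out⁻¹)) = 0
          simp only [Submodule.coe_zero, ContinuousMap.zero_apply, map_zero, Finset.sum_const_zero]
        map_add' := fun a b ↦ by
          change ∑ c : Γ ⧸ H, ω c.out (f (((a + b : coindModule σ) : C(Γ, M)) c.out⁻¹)) =
            ∑ c : Γ ⧸ H, ω c.out (f ((a : C(Γ, M)) c.out⁻¹)) + ∑ c : Γ ⧸ H, ω c.out (f ((b : C(Γ, M)) c.out⁻¹))
          rw [← Finset.sum_add_distrib]
          refine Finset.sum_congr rfl fun c _ ↦ ?_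
          rw [Submodule.coe_add, ContinuousMap.add_apply, map_add, map_add] }
    have hΘ₀ : ∀ a : coindModule σ, Θ₀ a = ∑ c : Γ ⧸ H, T a c := fun _ ↦ rfl
    let Θ : HomCarrier (coindModule σ) (MuCarrier F (p ^ k)) := HomCarrier.ofAddMonoidHom Θ₀
    have hΘ : ∀ a : coindModule σ, Θ a = ∑ c : Γ ⧸ H, T a c := fun _ ↦ rfl
    -- `Γ`-equivariance
    have hΘeq : ∀ (g : Γ) (a : coindModule σ), ω g (Θ a) = Θ (coindRep σ g a) := by
      intro g a
      rw [hΘ, hΘ, map_sum]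
      -- reindex the left sum along `c ↦ g⁻¹ • c`
      have hre : ∑ c : Γ ⧸ H, ω g (T a (g⁻¹ • c)) = ∑ c : Γ ⧸ H, ω g (T a c) :=
        Equiv.sum_comp (MulAction.toPerm (g⁻¹ : Γ)) (fun c ↦ ω g (T a c))
      rw [← hre]
      refine Finset.sum_congr rfl fun c _ ↦ ?_
      -- the term at `c`: `a*(c̃⁻¹ g) = h_c · a*(c̃'⁻¹)`
      have hmem := hperm g c
      have hprod : c.out⁻¹ * g = (c.out⁻¹ * g * (g⁻¹ • c).out) * ((g⁻¹ • c).out)⁻¹ := by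
        rw [mul_inv_cancel_right]
      change ω g (ω (g⁻¹ • c).out (f ((a : C(Γ, M)) ((g⁻¹ • c).out)⁻¹))) =
        ω c.out (f (((coindRep σ g a : coindModule σ) : C(Γ, M)) c.out⁻¹))
      rw [coindRep_apply_apply, hprod]
      have hco := (mem_coind_iff σ (a : C(Γ, M))).1 a.2 ⟨_, hmem⟩ ((g⁻¹ • c).out)⁻¹
      change (a : C(Γ, M)) (c.out⁻¹ * g * (g⁻¹ • c).out * ((g⁻¹ • c).out)⁻¹) = _ at hco
      rw [hco, hσ, hf ⟨_, hmem⟩, ← Module.End.mul_apply, ← map_mul, ← Module.End.mul_apply, ← map_mul]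
      congr 2
      rw [← mul_assoc, ← mul_assoc, mul_inv_cancel, one_mul]
    have hΘinv : Θ ∈ ((coindRep σ).homRep ω).toTopRep.ρ.invariants := fun g ↦
      (ContinuousRep.homRep_apply_eq_self_iff (coindRep σ) ω g Θ).mpr (hΘeq g)
    refine ⟨⟨Θ, hΘinv⟩, Subtype.ext (AddMonoidHom.ext fun m ↦ ?_)⟩
    -- `Φ_f ∘ j = f`: only the trivial coset contributes
    change Θ (j m) = f m
    rw [hΘ]
    have h1out : ((1 : Γ ⧸ H).out : Γ) ∈ H := by
      rw [← QuotientGroup.eq_one_iff, QuotientGroup.out_eq']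
    rw [Finset.sum_eq_single (1 : Γ ⧸ H)]
    · change ω (1 : Γ ⧸ H).out (f (((j m : coindModule σ) : C(Γ, M)) ((1 : Γ ⧸ H).out)⁻¹)) = f m
      rw [hj, if_pos (H.inv_mem h1out), hf ⟨_, H.inv_mem h1out⟩, ← Module.End.mul_apply, ← map_mul]
      change ω ((1 : Γ ⧸ H).out * ((1 : Γ ⧸ H).out)⁻¹) (f m) = f m
      rw [mul_inv_cancel, map_one, Module.End.one_apply]
    · intro c _ hc
      change ω c.out (f (((j m : coindModule σ) : C(Γ, M)) c.out⁻¹)) = 0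
      rw [hj, if_neg, map_zero, map_zero]
      intro hc'
      apply hc
      rw [← QuotientGroup.out_eq' c, QuotientGroup.eq_one_iff]
      simpa using H.inv_mem hc'
    · intro h; exact absurd (Finset.mem_univ _) h
  exact Nat.card_eq_of_bijective Ψ ⟨hΨ, hΨsurj⟩

end Summit.BirchSwinnertonDyer.BirchSwinnertonDyer.Theorems.InputsGreenbergLemma34Layer

end
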